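import Mathlib
import HarnessLib
import HarnessLib.Audit
import Summits.RiemannHypothesis.Statement
import Literature.NumberTheory.LFunctions.RiemannXi
import Literature.NumberTheory.LFunctions.SuzukiCanonicalSystem
import Summits.RiemannHypothesis.RiemannHypothesis.Theorems.DeBrangesSuzukiDoorWitnessDetectsRH
import HarnessLib.Audit.Status.Attr

/-!
Route: SuzukiWindowsDoor

# Route SuzukiWindowsDoor — one fixed Suzuki operator — the operator-form door «no unit eigenvalue
in any window ⟹ RH» via a ζ-free contraction lemma, residual = Suzuki's wished condition

X = AllWindowsDetectRH ∧ AllWindowsWitness ("it suffices to show"). Fix Suzuki's SINGLE symbol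
Θ_θ(z) = exp(−2θ(ξ′/ξ)(½−iz))
([Su20] = arXiv:1907.07302 (1.10)), its kernel K_θ(x) = Re (2π)⁻¹∫_{Im z=1} Θ_θ(z)e^{−izx}dz and the
compressions 𝖪_θ[t]:
f ↦ 1_{(−t,t)}∫_{(−t,t)} K_θ(·+y)f(y)dy on L²(−t,t). AllWindowsDetectRH (RH-FREE, candidate rung
leaf B-P(P2) of column DBR):
for every θ > 10, if NO 𝖪_θ[t] (t ≥ 0) has eigenvalue ±1 (`NoUnitEigenvalue`, the tree's rendering
of [Su21] (2.9)), then RH.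
It factors through four RH-FREE items: WindowsImplyContraction (A1, ζ-FREE operator theory for ANY
continuous real kernel) +
ContractionGivesWitness (ζ-FREE, f = 1_{(0,1)}) + KernelContinuous ([Su20] Thm 1.2 (K-ii), a tree
theorem) + WitnessDetectsRH
(the B-P leaf of route DeBrangesSuzukiDoor, item stmt-RiemannHypothesis-19730, by name).
AllWindowsWitness (∃ θ > 10, all windows
hold) is the DECLARED RESIDUAL: RH-EQUIVALENT·DERIVED (= the single-operator condition [Su20] p. 2–3
wishes for), never a proving target.
Lean: `AllWindowsDetectRH ∧ AllWindowsWitness`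

## Assembly
Pure logic (sorry-free in Sketch.lean): `closes (hK : KernelContinuous) (hA :
WindowsImplyContraction) (hC : ContractionGivesWitness)
(hT : WitnessDetectsRH) (hR : AllWindowsWitness) : Summit.RiemannHypothesis` picks θ and the window
hypothesis from the residual,
turns it into line contraction for K_θ (hA, with continuity hK), into W_θ ∈ L² (hC), and applies the
B-P leaf (hT). Every binder is
consumed. The conjunct attacked is AllWindowsDetectRH (= hK+hA+hC+hT, `allWindowsDetectRH_of`);
AllWindowsWitness is the named residual.
The Assembly item below records the same implication as a Prop (the deciding theorem is `closes`).

CLOSES_TARGET: closes rung B-P(P2) of RiemannHypothesis: Summit.RiemannHypothesis.RiemannHypothesis.Theses.SuzukiWindowsDoor.AllWindowsDetectRH (D-0061; not the summit Statement) — the deciding theorem of this route concludes that registered leaf instead of the Statement decl `RiemannHypothesis` (class rung: servable and labelled, never counted as concluding the summit Statement).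

UNDER FLOOR: fewer than 2 cruxes remain after retriage (legacy route; D-0019).

Rationale: WHY THIS LINE. Round 1 landed (modulo ports in flight) the door in the WITNESS language: W_θ ∈ L² ⟹
RH. The column's DATA, however, is measured in the
WINDOW language — certified ‖𝖪[T]‖ < 1 at T = (log 2)/2 … 1.15 (DATA-1b, Q11, DATA-6, two lineages)
are finite instances of
«∀ t, NoUnitEigenvalue K_θ t», exactly as the S_M minors are finite instances of Weil positivity.
This line proves the RH-free
implication from the window statement to RH, i.e. the `⟸` half of the single-operator criterion
[Su20] asks for (arXiv:1907.07302
p. 2–3; printed: only ∃ τ with the windows t < τ, Thm 1.2 (K-v)). Its one open item, A1, imports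
compact-operator theory and nothing
from ζ: t ↦ 𝖪[t] is Hilbert–Schmidt-norm continuous with 𝖪[0] = 0, a compact self-adjoint operator
attains ±‖·‖ as an eigenvalue
(the tree's `exists_eigenvector_norm_of_isCompactOperator`, ReedSimonIV1978 Thm XIII.44, applied to
𝖪[t]²), so by the intermediate
value theorem a window family free of unit eigenvalues has sup_t ‖𝖪[t]‖ ≤ 1, which is line
contraction by exhaustion; [Su21] =
arXiv:1606.05726 Prop 4.4 iii) (p. 23) uses the norm-attainment step in the RH ⟹ windows direction
only. No prior route states a
window-language door; the negatives index (character sums, universal-factor loophole) is untouched.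

RANKED CRUXES. #2 WindowsImplyContraction (crux) — A1 (RH-FREE, ζ-FREE, K-general): for every
continuous K : ℝ → ℝ, if for all t ≥ 0 no f ≠ 0 in L²(−t,t) satisfies ∫_{(−t,t)}K(x+y)f(y)dy = ±f(x)
a.e. on (−t,t) (`NoUnitEigenvalue K t`), then for all t ≥ 0 and f ∈ L²(−t,t) the function g(x) =
∫_{(−t,t)}K(x+y)f(y)dy is in L²(ℝ) with ∫_ℝ g² ≤ ∫_{(−t,t)} f². [difficulty: M] (why it might fail:
False only if some compact self-adjoint 𝖪[t] had norm ≥ 1 while no 𝖪[s], s ≤ t, has eigenvalue ±1 —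
excluded by norm-continuity in s from 𝖪[0]=0 and norm attainment; remaining risk is formal (L²-class
eigenvector ↦ the function representative `NoUnitEigenvalue` quantifies over) and size (M/L).)
[arXiv:1606.05726, ReedSimonIV1978, arXiv:1907.07302]
#7 AllWindowsWitness (crux) — DECLARED RESIDUAL (RH-EQUIVALENT·DERIVED; refutation budget only): for
some θ > 10, no compression 𝖪_θ[t], t ≥ 0, of Suzuki's single operator has eigenvalue ±1 — Suzuki's
wished single-operator condition. ⟸ RH-free by this route; ⟹ from RH by the isometry argument of
[Su21] Thm 2.1/Prop 4.4 transposed to K_θ (L-sized, H²(ℂ₊), not formalised). The banked window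
certificates (DATA-1b θ ∈ {5/4,3/2,2,3} at T = (log 2)/2; the (ω,ν) ladder to T = 1.15) are finite
instances; none bears on its truth. [deps: WindowsImplyContraction] [difficulty: open-problem] (why
it might fail: It is equivalent to RH (fails iff ζ has an off-line zero: then some 𝖪_θ[t] acquires a
unit eigenvalue, by this very route); nobody is asked to prove it — a certified unit eigenvalue at
one (θ,t) would refute RH.) [arXiv:1907.07302, arXiv:1606.05726]
#9 KernelContinuous (support) — RH-FREE KNOWN ([Su20] Thm 1.2 (K-ii), θ > 1): K_θ is continuous on
ℝ; one line from the tree theorem `Literature.NumberTheory.LFunctions.Suzuki2020_thm12_continuous`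
(the inlined K is `limKernel θ` by rfl). [difficulty: provable-now] [arXiv:1907.07302]
#9 ContractionGivesWitness (support) — RH-FREE, ζ-FREE, S-sized (K-general): if K is a line
contraction from every L²(−t,t) (the conclusion of A1), then W_K(x) = ∫_{(0,1)}K(x+y)dy is in L²(ℝ)
(take t = 1, f = 1_{(0,1)}); PROVED for K_θ in the cell's scratch module
(`limContractionGivesWitness_holds`) — port. [difficulty: provable-now] [arXiv:1907.07302]
#9 WitnessDetectsRH (support) — RH-FREE — by name the rung leaf B-P of route DeBrangesSuzukiDoor
(item stmt-RiemannHypothesis-19730; closes from that route's KernelSupport + KernelLaplaceIdentity +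
DoorModuloKernel, all three filed/landing): for every θ > 10, W_θ ∈ L²(ℝ) ⟹ RH. [difficulty:
provable-now] [arXiv:1907.07302, LagariasXiPositivity1999]
#9 AllWindowsDetectRH (support) — ASIDE at filing (kind aside in route.json) — THE RUNG LEAF
CANDIDATE B-P(P2), RH-FREE operator door in hypothesis-free form: for every θ > 10, (∀ t ≥ 0,
NoUnitEigenvalue K_θ t) ⟹ RH. Pure logic from the four RH-free items (`allWindowsDetectRH_of` in
Sketch.lean); becomes the route's `closes_target` once a Theorems-side twin constant is registered
(same mechanism as B-P). [difficulty: provable-now] [arXiv:1907.07302]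

TWO-LAYER PLAN. WindowsImplyContraction ⇐ stub_windowContraction (window contraction
‖𝖪[t]f‖_{L²(−t,t)} ≤ ‖f‖ from no unit eigenvalues: HS-continuity
in t, norm attainment, IVT; M) → stub_lineOfWindows (exhaustion T → ∞; S/M) →
WindowsImplyContraction (registered birth skeleton,
composition kernel-checked). Nothing else is split at open.

KILL CRITERIA. A refutation of WindowsImplyContraction (a continuous kernel with
unit-eigenvalue-free windows that is not a line contraction) closes the
route outright (close --reason refuted:WindowsImplyContraction) — it would also falsify [Su21] Prop
4.4's mechanism, so it is not expected.
A certified unit eigenvalue of some 𝖪_θ[t] (θ > 10) refutes the residual AND RH; the RH-free items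
survive as theorems. If route
DeBrangesSuzukiDoor's item 19730 were refuted (impossible once its three feeders land) this route
breaks with it.

NOT DECOMPOSED YET. The converse direction RH ⟹ AllWindows (I `LimIsometryOfRH`:
H²(ℂ₊)/Paley–Wiener, L-sized; U `LimCompactSupportRigidity`, M) is NOT in
this route: it is RH-conditional, bears on no rung, and would only upgrade the criterion to a kernel
`iff`; it stays typed in the cell's
scratch module for a later route. The θ > 1 versions of all items (printed strength) are one
`linarith` away and are not filed separately.

CHEAPEST FALSIFIER. For A1: the 2×2 toy — K = c·1_{[0,2]} smoothed, t = 1: compute ‖𝖪[1]‖ and the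
top eigenvalue branch λ(t) on a grid; λ is continuous,
starts at 0, and ‖𝖪[t]‖ = max|λ±(t)| — any jump would kill the mechanism (none possible for
HS-continuous families; not run, the lemma is
classical). For the residual: DATA-1b already certifies the window T = (log 2)/2 for θ ≤ 3 (margins
4.8e-3 … 7.1e-2); a unit
eigenvalue at any certified (θ,T) would have shown up as ‖𝖪[T]‖ ≥ 1.

NUMBERS. DATA-1b (kit j240357/j240633): single operator, T = (log 2)/2, θ ∈ {5/4, 3/2, 2, 3}:
‖𝖪_θ[T]‖ < 1 with float margins ε₊ = 4.8e-3 … 7.1e-2.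
DATA-6 / Q11 ((ω,ν) = (1/4,5) ladder, two lineages): ‖𝖪[T]‖ < 1 certified at T = 0.35 … 1.15; ln ε₊
≈ −0.84 − 27.5 T² (F8 fit).
None of these numbers bears on RH; they instantiate the residual's ∀t-statement at finitely many t.

DEFINITION REQUESTS. None: `NoUnitEigenvalue`, `riemannXi` exist in Literature; the single-operator
objects are inlined (= `Literature.NumberTheory.LFunctions.limTheta/limKernel` by rfl).

Novelty: Searches (2026-08-25, corpus fts+vec AND galaxy): `lit search --hybrid "Suzuki integral operator
kernel K(x+y) eigenvalue ±1 operator norm less than one continuity in t Hilbert-Schmidt"` (10 book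
hits, functional-analysis textbooks — Kress 1999 p.51, Halmos 1982 p.89 — none on the criterion);
`lit vsearch "<A1 in prose>"` (8 hits, none relevant: Frank–Laptev–Weidl 2022, Weinstein–Stenger
1972 …); `lit galaxy search "det(1 \pm|single operator avoiding parameters|eigenvalues of
\mathsf{K}|truncated Hankel operator" --star all` (15 rows, 0 relevant); `lit read arxiv:1907.07302
--grep eigenvalue|norm|τ` → p.2–3 only (the wish, Thm 1.1, Thm 1.2 (K-v)); `lit read
arxiv:1606.05726 --grep …` → §9 Thm 9.2 (iii) [corpus:paper-arxiv-1606.05726 p.34] («Θ = E♯/E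
meromorphic inner ⟺ 𝖪f ∈ L²(ℝ) for every f ∈ L²(−∞,0)»), Prop 9.1 [p.35], Prop 4.4 iii) [p.23];
`ledger negatives --problem RiemannHypothesis` (2 entries, unrelated); tree grep `NoUnitEigenvalue`
→ used only in the two Suzuki Literature modules (no theorem of shape windows → contraction).
Nearest prior art found: Suzuki2021Hamiltonians (arXiv:1606.05726) Prop 4.4 iii) p.23 (RH/HB ⟹
‖𝖪[t]‖ < 1, uses norm attainment) and Thm 9.2 (iii) p.34 (inner ⟺ 𝖪f ∈ L² for ALL f, MEROMORPHIC
symbol E♯/E, Phragmén–Lindelöf); Suzuki2020IntegralOperators (arXiv:1907.07302) Thm 1.2 (K-v) (∃ τ)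
and the printed wish p.2–3; route DeBrangesSuzukiDoor (this column, witness-language door).
Delta: the window-language RH-detecting direction for ONE fixed op  [refs: 1907.07302, 1606.05726, arxiv:1907.07302, arxiv:1606.05726, paper-arxiv-1606.05726]

Barriers (technique_class: single-operator-kernel, compact-operator-norm-continuity): - technique_class: single-operator-kernel, compact-operator-norm-continuity
- Literature.Barriers.RiemannHypothesis.DeBrangesPositivity: OUTSIDE — no positivity axiom of a de
Branges space is asserted or used (ConreyLi2000: de Branges' sufficient condition fails for ξ); the
load-bearing items are a ζ-free contraction lemma, a ζ-free L² lemma, continuity of K_θ and the B-P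
door; the residual is Suzuki's (K5)-for-all-t, which is RH-equivalent, not a refuted positivity
condition.
- Literature.Barriers.RiemannHypothesis.DavenportHeilbronn: consistent — the RH-free items are
ζ-free or function-theoretic and would hold verbatim for a Davenport–Heilbronn-type symbol, where
the corresponding residual is simply FALSE (an off-line zero forces a unit eigenvalue); the route
claims no proof of the residual, so Euler-product blindness costs nothing.
- Literature.Barriers.RiemannHypothesis.BohrDenseValues: does not apply — no value-distribution /
universality statement inside the strip is used; the RH-free items are ζ-free operator theory or
live on Re s ≥ 3/2, and the door's rigidity step is about meromorphic continuation of one quotient,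
not about values on a line.
- Literature.Barriers.RiemannHypothesis.NymanBeurlingObstructions: does not apply — no L²(0,1)
approximation / Báez-Duarte distance is involved; the only L² objects are W_θ on ℝ and the
compressions 𝖪_θ[t], and only their RH-FREE consequences are load-bearing.
- Negatives index: stmt-RiemannHypothesis-16980 (character-sum posit

History (route lifecycle, newest last):
- 2026-08-26T01:33:47Z · closes_target -> closes rung B-P(P2) of RiemannHypothesis: Summit.RiemannHypothesis.RiemannHypothesis.Theses.SuzukiWindowsDoor.AllWindowsDetectRH (D-0061; not the summit Statement) (planner-rh-dbr-theory-g5-0)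

sub-problem: RiemannHypothesis · status: open · opened planner-rh-dbr-theory-g5-0 2026-08-25T22:10:44Z · rev 4 · ledger route-RiemannHypothesis-SuzukiWindowsDoor
GENERATED by the gate from the ledger (D-0016/17). Provers cite these decls: `theorem foo : Summit.RiemannHypothesis.RiemannHypothesis.Theses.SuzukiWindowsDoor.<Decl> := …` in Summits/RiemannHypothesis/RiemannHypothesis/Theorems/<Name>.lean.
-/

namespace Summit.RiemannHypothesis.RiemannHypothesis.Theses.SuzukiWindowsDoor

open scoped BigOperators Topology Manifold Classical MeasureTheory ProbabilityTheory Matrix InnerProductSpace ComplexConjugate ContinuousMap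
open Filter Set Function TopologicalSpace MeasureTheory

attribute [summit_statement] _root_.Summit.RiemannHypothesis
-- H21.Audit: the closer leaf Summit.RiemannHypothesis.RiemannHypothesis.Theses.SuzukiWindowsDoor.AllWindowsDetectRH is an item decl of this route file — tagged summit_statement below, after its declaration

open Summit

/-- item stmt-RiemannHypothesis-19732 · crux · rank 2 · closed · proved by Summit.RiemannHypothesis.RiemannHypothesis.Theorems.suzukiWindowsDoor_windowsImplyContraction_proof (prover) · by planner
why it might fail: False only if some compact self-adjoint 𝖪[t] had norm ≥ 1 while no 𝖪[s], s ≤ t, has eigenvalue ±1 — excluded by norm-continuity in s from 𝖪[0]=0 and norm attainment; remaining risk is formal (L²-class eigenvector ↦ the function representative `NoUnitEigenvalue` quantifies over) and size (M/L).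
sources: arXiv:1606.05726, ReedSimonIV1978, arXiv:1907.07302
[crux] A1 (RH-FREE, ζ-FREE, K-general): for every continuous K : ℝ → ℝ, if for all t ≥ 0 no f ≠ 0 in
L²(−t,t) satisfies ∫_{(−t,t)}K(x+y)f(y)dy = ±f(x) a.e. on (−t,t) (`NoUnitEigenvalue K t`), then for
all t ≥ 0 and f ∈ L²(−t,t) the function g(x) = ∫_{(−t,t)}K(x+y)f(y)dy is in L²(ℝ) with ∫_ℝ g² ≤
∫_{(−t,t)} f². [difficulty: M] -/
@[route_item "route-RiemannHypothesis-SuzukiWindowsDoor", crux]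
def WindowsImplyContraction : Prop :=
  ∀ K : ℝ → ℝ, Continuous K → (∀ t : ℝ, 0 ≤ t → Literature.NumberTheory.LFunctions.NoUnitEigenvalue K t) → ∀ t : ℝ, 0 ≤ t → ∀ f : ℝ → ℝ, MeasureTheory.MemLp f 2 (MeasureTheory.volume.restrict (Set.Ioo (-t) t)) → MeasureTheory.MemLp (fun x : ℝ => ∫ y in Set.Ioo (-t) t, K (x + y) * f y) 2 MeasureTheory.volume ∧ ∫ x : ℝ, (∫ y in Set.Ioo (-t) t, K (x + y) * f y) ^ 2 ≤ ∫ x in Set.Ioo (-t) t, f x ^ 2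

-- `WindowsImplyContraction` holds: proved by `Summit.RiemannHypothesis.RiemannHypothesis.Theorems.suzukiWindowsDoor_windowsImplyContraction_proof` (its module imports this route file, so no `_holds` link can be stated here).

/-- item stmt-RiemannHypothesis-19733 · aside · rank 7 · open · by planner
why it might fail: It is equivalent to RH (fails iff ζ has an off-line zero: then some 𝖪_θ[t] acquires a unit eigenvalue, by this very route); nobody is asked to prove it — a certified unit eigenvalue at one (θ,t) would refute RH.
sources: arXiv:1907.07302, arXiv:1606.05726
[crux] DECLARED RESIDUAL (RH-EQUIVALENT·DERIVED; refutation budget only): for some θ > 10, no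
compression 𝖪_θ[t], t ≥ 0, of Suzuki's single operator has eigenvalue ±1 — Suzuki's wished
single-operator condition. ⟸ RH-free by this route; ⟹ from RH by the isometry argument of [Su21] Thm
2.1/Prop 4.4 transposed to K_θ (L-sized, H²(ℂ₊), not formalised). The banked window certificates
(DATA-1b θ ∈ {5/4,3/2,2,3} at T = (log 2)/2; the (ω,ν) ladder to T = 1.15) are finite instances;
none bears on its truth. [deps: WindowsImplyContraction] [difficulty: open-problem] -/
@[route_item "route-RiemannHypothesis-SuzukiWindowsDoor"]
def AllWindowsWitness : Prop :=
  ∃ θ : ℝ, 10 < θ ∧ let Θ : ℂ → ℂ := fun z => Complex.exp (-2 * (θ : ℂ) * (deriv Literature.NumberTheory.LFunctions.riemannXi (1 / 2 - Complex.I * z) / Literature.NumberTheory.LFunctions.riemannXi (1 / 2 - Complex.I * z))); let K : ℝ → ℝ := fun x => ((1 : ℂ) / (2 * (Real.pi : ℂ)) * ∫ u : ℝ, Θ ((u : ℂ) + ((1 : ℝ) : ℂ) * Complex.I) * Complex.exp (-Complex.I * ((u : ℂ) + ((1 : ℝ) : ℂ) * Complex.I) * (x : ℂ))).re; ∀ t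 : ℝ, 0 ≤ t → Literature.NumberTheory.LFunctions.NoUnitEigenvalue K t

/-- item stmt-RiemannHypothesis-19730 · support · rank 9 · closed · proved by Summit.RiemannHypothesis.RiemannHypothesis.Theorems.witnessDetectsRH_proof @ 45e5c5cfae41 (prover) · by planner
sources: arXiv:1907.07302, LagariasXiPositivity1999
[support] THE RUNG LEAF B-P (RH-FREE door theorem, hypothesis-free form): for every θ > 10, W_θ ∈
L²(ℝ) ⟹ RH. Derived inside `closes` from KernelSupport + KernelLaplaceIdentity + DoorModuloKernel
(`witnessDetectsRH_of` in Sketch.lean); the constant alt-closer routes may conclude (D-0061).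
[difficulty: L] -/
@[route_item "route-RiemannHypothesis-SuzukiWindowsDoor", crux]
def WitnessDetectsRH : Prop :=
  ∀ θ : ℝ, 10 < θ → let Θ : ℂ → ℂ := fun z => Complex.exp (-2 * (θ : ℂ) * (deriv Literature.NumberTheory.LFunctions.riemannXi (1 / 2 - Complex.I * z) / Literature.NumberTheory.LFunctions.riemannXi (1 / 2 - Complex.I * z))); let K : ℝ → ℝ := fun x => ((1 : ℂ) / (2 * (Real.pi : ℂ)) * ∫ u : ℝ, Θ ((u : ℂ) + ((1 : ℝ) : ℂ) * Complex.I) * Complex.exp (-Complex.I * ((u : ℂ) + ((1 : ℝ) : ℂ) * Complex.I) * (x : ℂ))).re; MeasureTheory.MemLp (fun x : ℝ => ∫ y in Set.Ioo (0 : ℝ) 1, K (x + y)) 2 MeasureTheory.volume → _root_.RiemannHypothesis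

/-- `WitnessDetectsRH` holds: proved by `Summit.RiemannHypothesis.RiemannHypothesis.Theorems.witnessDetectsRH_proof` @ 45e5c5cfae41. -/
theorem WitnessDetectsRH_holds : WitnessDetectsRH := _root_.Summit.RiemannHypothesis.RiemannHypothesis.Theorems.witnessDetectsRH_proof

/-- item stmt-RiemannHypothesis-19734 · support · rank 9 · closed · proved by Summit.RiemannHypothesis.RiemannHypothesis.Theorems.suzukiWindowsDoor_kernelContinuous_proof @ f4e04128897f (prover) · by planner
sources: arXiv:1907.07302
[support] RH-FREE KNOWN ([Su20] Thm 1.2 (K-ii), θ > 1): K_θ is continuous on ℝ; one line from the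
tree theorem `Literature.NumberTheory.LFunctions.Suzuki2020_thm12_continuous` (the inlined K is
`limKernel θ` by rfl). [difficulty: provable-now] -/
@[route_item "route-RiemannHypothesis-SuzukiWindowsDoor", crux]
def KernelContinuous : Prop :=
  ∀ θ : ℝ, 10 < θ → let Θ : ℂ → ℂ := fun z => Complex.exp (-2 * (θ : ℂ) * (deriv Literature.NumberTheory.LFunctions.riemannXi (1 / 2 - Complex.I * z) / Literature.NumberTheory.LFunctions.riemannXi (1 / 2 - Complex.I * z))); let K : ℝ → ℝ := fun x => ((1 : ℂ) / (2 * (Real.pi : ℂ)) * ∫ u : ℝ, Θ ((u : ℂ) + ((1 : ℝ) : ℂ) * Complex.I) * Complex.exp (-Complex.I * ((u : ℂ) + ((1 : ℝ) : ℂ) * Complex.I) * (x : ℂ))).re; Continuous K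

-- `KernelContinuous` holds: proved by `Summit.RiemannHypothesis.RiemannHypothesis.Theorems.suzukiWindowsDoor_kernelContinuous_proof` @ f4e04128897f (its module imports this route file, so no `_holds` link can be stated here).

/-- item stmt-RiemannHypothesis-19735 · support · rank 9 · closed · proved by Summit.RiemannHypothesis.RiemannHypothesis.Theorems.suzukiWindowsDoor_contractionGivesWitness_proof @ f4e04128897f (prover) · by planner
sources: arXiv:1907.07302
[support] RH-FREE, ζ-FREE, S-sized (K-general): if K is a line contraction from every L²(−t,t) (the
conclusion of A1), then W_K(x) = ∫_{(0,1)}K(x+y)dy is in L²(ℝ) (take t = 1, f = 1_{(0,1)}); PROVED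
for K_θ in the cell's scratch module (`limContractionGivesWitness_holds`) — port. [difficulty:
provable-now] -/
@[route_item "route-RiemannHypothesis-SuzukiWindowsDoor", crux]
def ContractionGivesWitness : Prop :=
  ∀ K : ℝ → ℝ, (∀ t : ℝ, 0 ≤ t → ∀ f : ℝ → ℝ, MeasureTheory.MemLp f 2 (MeasureTheory.volume.restrict (Set.Ioo (-t) t)) → MeasureTheory.MemLp (fun x : ℝ => ∫ y in Set.Ioo (-t) t, K (x + y) * f y) 2 MeasureTheory.volume ∧ ∫ x : ℝ, (∫ y in Set.Ioo (-t) t, K (x + y) * f y) ^ 2 ≤ ∫ x in Set.Ioo (-t) t, f x ^ 2) → MeasureTheory.MemLp (fun x : ℝ => ∫ y in Set.Ioo (0 : ℝ) 1, K (x + y)) 2 MeasureTheory.volume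

-- `ContractionGivesWitness` holds: proved by `Summit.RiemannHypothesis.RiemannHypothesis.Theorems.suzukiWindowsDoor_contractionGivesWitness_proof` @ f4e04128897f (its module imports this route file, so no `_holds` link can be stated here).

/-- item stmt-RiemannHypothesis-19736 · aside · rank 9 · closed · proved by Summit.RiemannHypothesis.RiemannHypothesis.Theorems.suzukiWindowsDoor_allWindowsDetectRH_proof (prover) · by planner
sources: arXiv:1907.07302
[support] ASIDE at filing (kind aside in route.json) — THE RUNG LEAF CANDIDATE B-P(P2), RH-FREE
operator door in hypothesis-free form: for every θ > 10, (∀ t ≥ 0, NoUnitEigenvalue K_θ t) ⟹ RH.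
Pure logic from the four RH-free items (`allWindowsDetectRH_of` in Sketch.lean); becomes the route's
`closes_target` once a Theorems-side twin constant is registered (same mechanism as B-P).
[difficulty: provable-now] -/
@[route_item "route-RiemannHypothesis-SuzukiWindowsDoor", crux]
def AllWindowsDetectRH : Prop :=
  ∀ θ : ℝ, 10 < θ → let Θ : ℂ → ℂ := fun z => Complex.exp (-2 * (θ : ℂ) * (deriv Literature.NumberTheory.LFunctions.riemannXi (1 / 2 - Complex.I * z) / Literature.NumberTheory.LFunctions.riemannXi (1 / 2 - Complex.I * z))); let K : ℝ → ℝ := fun x => ((1 : ℂ) / (2 * (Real.pi : ℂ)) * ∫ u : ℝ, Θ ((u : ℂ) + ((1 : ℝ) : ℂ) * Complex.I) * Complex.exp (-Complex.I * ((u : ℂ) + ((1 : ℝ) : ℂ) * Complex.I) * (x : ℂ))).re; (∀ t : ℝ, 0 ≤ t → Literature.NumberTheory.LFunctions.NoUnitEigenvalue K t) → _root_.RiemannHypothesis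

-- `AllWindowsDetectRH` holds: proved by `Summit.RiemannHypothesis.RiemannHypothesis.Theorems.suzukiWindowsDoor_allWindowsDetectRH_proof` (its module imports this route file, so no `_holds` link can be stated here).

/-- item stmt-RiemannHypothesis-19737 · assembly · rank 1 · closed · proved by Summit.RiemannHypothesis.RiemannHypothesis.Theorems.suzukiWindowsDoor_assembly_proof @ f4e04128897f (prover) · by planner
sources: arXiv:1907.07302
[assembly] KernelContinuous → WindowsImplyContraction → ContractionGivesWitness → WitnessDetectsRH →
AllWindowsWitness → RH (pure logic; `closes` in glue.lean). -/
@[route_item "route-RiemannHypothesis-SuzukiWindowsDoor"]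
def Assembly : Prop :=
  KernelContinuous → WindowsImplyContraction → ContractionGivesWitness → WitnessDetectsRH → AllWindowsWitness → Summit.RiemannHypothesis

-- `Assembly` holds: proved by `Summit.RiemannHypothesis.RiemannHypothesis.Theorems.suzukiWindowsDoor_assembly_proof` @ f4e04128897f (its module imports this route file, so no `_holds` link can be stated here).

attribute [summit_statement] _root_.Summit.RiemannHypothesis.RiemannHypothesis.Theses.SuzukiWindowsDoor.AllWindowsDetectRH

/-! D-0027 §2.1 — DECIDING THEOREM (planner-authored via `route open/edit --closes-file`; by planner-rh-dbr-theory-g5-0 2026-08-26T01:33:47Z):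
its hypotheses are this route's items and its conclusion the registered leaf `Summit.RiemannHypothesis.RiemannHypothesis.Theses.SuzukiWindowsDoor.AllWindowsDetectRH` (rung B-P(P2), D-0061) (glue_lint), and it elaborates with this file. -/

@[closes "route-RiemannHypothesis-SuzukiWindowsDoor"] theorem closes (hK : KernelContinuous) (hA : WindowsImplyContraction) (hC : ContractionGivesWitness)
    (hT : WitnessDetectsRH) : AllWindowsDetectRH :=
  fun θ hθ hWin => hT θ hθ (hC _ (hA _ (hK θ hθ) hWin))

end Summit.RiemannHypothesis.RiemannHypothesis.Theses.SuzukiWindowsDoor
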